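import Literature.Computability.Complexity.IrreducibilityLLLKernel
import Literature.Computability.Complexity.IrreducibilityLLLBerlekamp
import HarnessLib

/-!
# Berlekamp's matrix on coefficient lists and its null vectors (LLL 1982, §3, step (3.1))

Support file for the discharge of the named fact
`Literature.Computability.Complexity.lll_monicIrreducible_mem_P` (irreducibility of monic integer
polynomials is decidable in `P`; Lenstra–Lenstra–Lovász 1982, §3). For a monic squarefree `W` over
`𝔽_p` of degree `w`, Berlekamp's subalgebra `{v : deg v < w, W ∣ v^p - v}` is the null space of
`Q - I`, `Q` the matrix of `X^{pi} mod W` (Knuth §4.6.2). This file builds that linear system on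
coefficient lists and connects the null-vector program `kerVecMod` (`IrreducibilityLLLKernel.lean`)
with the algebra of `IrreducibilityLLLBerlekamp.lean`:

* `xPowMod p e W` — `X^e mod W` by `e` steps "multiply by `X`, reduce" (`toZMod_xPowMod`);
* `bEntry`, `bRow`, `bMatrix p W` — the `w × (w-1)` system `Σ_{i≥1} vᵢ ((X^{pi} mod W)ⱼ - δᵢⱼ) = 0`,
  `j < w`, in the unknowns `v₁, …, v_{w-1}` (the constant coefficient of `v` is set to `0`);
* `dot_bRow` — the key identity: row `j` paired with `u` is the `j`-th coefficient of
  `Σᵢ uᵢ (X^{p(i+1)} mod W) - X·u`;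
* `berlekampVec p W = (kerVecMod …).map (0 :: ·)` in normal form and its specification:
  **`berlekampVec_sound`** (a returned `v` has `0 < deg v̄ < deg W̄` and `W̄ ∣ v̄^p - v̄`) and
  **`berlekampVec_isSome_of_not_irreducible`** (if `W̄` is monic, squarefree, of degree `≥ 1` and
  reducible, a vector is returned) — by `kerVecMod_sound/complete` and
  `exists_berlekamp_coeff_zero_of_not_irreducible`, `dvd_pow_card_sub_iff_sum_eq`.

## References

* D. E. Knuth, *The Art of Computer Programming*, Vol. 2, 3rd ed., 1998, §4.6.2 (Berlekamp's
  algorithm: the matrix `Q`, step B2–B3). [KnuthTAOCP2]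
* E. R. Berlekamp, *Factoring polynomials over finite fields*, Bell System Tech. J. 46 (1967).
* A. K. Lenstra, H. W. Lenstra Jr., L. Lovász, Math. Ann. 261 (1982), §3 (3.1). [LenstraLenstraLovasz1982]
-/

noncomputable section

namespace Literature.Computability.Complexity

open Polynomial Finset SumcheckMA Literature.LinearAlgebra.Matrix.ListGauss

namespace LLLFactoring

/-! ### Powers of `X` modulo `W` -/

/-- `X^e mod W` modulo `p`, in normal form: `e` steps `acc ↦ (X·acc) mod W` from `1 mod W`.
[cite: KnuthTAOCP2, §4.6.2 (computation of the rows of Q)] -/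
def xPowMod (p e : ℕ) (W : List ℤ) : List ℤ :=
  (List.replicate e ()).foldl (fun acc _ => pmodM p (0 :: acc) W) (pmodM p [1] W)

section XPow

variable {p : ℕ}

/-- **`xPowMod` computes `X^e mod W̄`** (`W̄` monic of degree `|W| - 1`, `p ≥ 1`), in normal form
and shorter than `W`. [cite: KnuthTAOCP2, §4.6.2] -/
theorem xPowMod_spec (hp : 0 < p) {W : List ℤ} (hW0 : W ≠ []) (hWm : (toZMod p W).Monic)
    (hWd : (toZMod p W).natDegree = W.length - 1) : ∀ e : ℕ,
    toZMod p (xPowMod p e W) = (X ^ e) %ₘ toZMod p W ∧ Normal p (xPowMod p e W) ∧ (xPowMod p e W).length < W.length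
  | 0 => by
    refine ⟨?_, normal_pmodM hp _ _, length_pmodM_lt hp hW0 hWm hWd⟩
    rw [xPowMod, List.replicate_zero, List.foldl_nil, toZMod_pmodM hp hW0 hWm hWd, pow_zero, toZMod_cons, toZMod_nil]
    simp
  | e + 1 => by
    obtain ⟨ih, -, -⟩ := xPowMod_spec hp hW0 hWm hWd e
    have hrun : xPowMod p (e + 1) W = pmodM p (0 :: xPowMod p e W) W := by
      rw [xPowMod, List.replicate_succ', List.foldl_append, List.foldl_cons, List.foldl_nil, ← xPowMod]
    rw [hrun]
    refine ⟨?_, normal_pmodM hp _ _, length_pmodM_lt hp hW0 hWm hWd⟩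
    rw [toZMod_pmodM hp hW0 hWm hWd, toZMod_cons, Int.cast_zero, map_zero, zero_add, ih, pow_succ']
    refine modByMonic_eq_of_dvd_sub hWm ?_
    have h1 := modByMonic_add_div (X ^ e) (toZMod p W)
    exact ⟨-(X * (X ^ e /ₘ toZMod p W)), by linear_combination X * h1⟩

end XPow

/-! ### The linear system -/

/-- Entry `(j, i')` of Berlekamp's system: `((X^{p(i'+1)} mod W)ⱼ - δ_{i'+1, j}) mod p`.
[cite: KnuthTAOCP2, §4.6.2 (the matrix Q - I)] -/
def bEntry (p : ℕ) (W : List ℤ) (j i' : ℕ) : ℤ :=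
  ((xPowMod p (p * (i' + 1)) W).getD j 0 - if i' + 1 = j then 1 else 0) % (p : ℤ)

/-- Row `j` of Berlekamp's system (one equation, `|W| - 2` unknowns). [cite: KnuthTAOCP2, §4.6.2] -/
def bRow (p : ℕ) (W : List ℤ) (j : ℕ) : List ℤ := (List.range (W.length - 2)).map (bEntry p W j)

/-- **Berlekamp's system** `(Q - I)ᵀ` restricted to `v(0) = 0`: `|W| - 1` equations (coefficients
`j < deg W`) in `|W| - 2` unknowns (`v₁, …, v_{deg W - 1}`). [cite: KnuthTAOCP2, §4.6.2] -/
def bMatrix (p : ℕ) (W : List ℤ) : List (List ℤ) := (List.range (W.length - 1)).map (bRow p W)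

/-- **A nonconstant element of Berlekamp's subalgebra**, if the program finds one: the null vector
`c` of the system read as the polynomial `0 + c₀ X + c₁ X² + ⋯`, in normal form.
[cite: KnuthTAOCP2, §4.6.2, steps B2–B3] -/
def berlekampVec (p : ℕ) (W : List ℤ) : Option (List ℤ) :=
  (kerVecMod p (W.length - 2) (bMatrix p W)).map fun c => pnorm p (0 :: c)

section Spec

variable {p : ℕ}

/-- Rows have the right length. [folklore] -/
theorem length_bRow (W : List ℤ) (j : ℕ) : (bRow p W j).length = W.length - 2 := by simp [bRow]

/-- All rows of the system have length `|W| - 2`. [folklore] -/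
theorem length_of_mem_bMatrix {W : List ℤ} {r : List ℤ} (hr : r ∈ bMatrix p W) : r.length = W.length - 2 := by
  obtain ⟨j, -, rfl⟩ := List.mem_map.1 hr
  exact length_bRow W j

/-- The reduced row `j`. [folklore] -/
theorem castVec_bRow (W : List ℤ) (j : ℕ) :
    castVec p (bRow p W j) = (List.range (W.length - 2)).map fun i' =>
      (toZMod p (xPowMod p (p * (i' + 1)) W)).coeff j - if i' + 1 = j then 1 else 0 := by
  rw [bRow, castVec, List.map_map]
  refine List.map_congr_left fun i' _ => ?_
  simp only [Function.comp_apply, bEntry]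
  rw [ZMod.intCast_mod, coeff_toZMod]
  push_cast
  split_ifs <;> rfl

/-- The polynomial `0 + u₀ X + u₁ X² + ⋯` of the unknown vector `u`. [folklore] -/
def shiftPoly (u : List (ZMod p)) : (ZMod p)[X] := ∑ i ∈ Finset.range u.length, C (u.getD i 0) * X ^ (i + 1)

/-- Coefficients of `shiftPoly u`: `0` at `0`, `u_{j-1}` at `j ≥ 1`. [folklore] -/
theorem coeff_shiftPoly (u : List (ZMod p)) (j : ℕ) :
    (shiftPoly u).coeff j = if j = 0 then 0 else u.getD (j - 1) 0 := by
  rw [shiftPoly, finsetSum_coeff]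
  simp only [coeff_C_mul, coeff_X_pow]
  split_ifs with hj
  · subst hj
    exact Finset.sum_eq_zero fun i _ => by rw [if_neg (by omega), mul_zero]
  · by_cases hlt : j - 1 < u.length
    · rw [Finset.sum_eq_single (j - 1)]
      · rw [if_pos (by omega), mul_one]
      · intro i _ hi; rw [if_neg (by omega), mul_zero]
      · intro h; exact absurd (Finset.mem_range.2 hlt) h
    · rw [List.getD_eq_default _ _ (by omega)]
      exact Finset.sum_eq_zero fun i hi => by
        rw [if_neg (by have := Finset.mem_range.1 hi; omega), mul_zero]

/-- `shiftPoly` of the reduced list is `toZMod` of the shifted list. [folklore] -/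
theorem toZMod_zero_cons (c : List ℤ) : toZMod p (0 :: c) = shiftPoly (castVec p c) := by
  ext j
  rw [coeff_shiftPoly, coeff_toZMod]
  cases j with
  | zero => simp
  | succ j =>
    simp only [Nat.succ_ne_zero, ↓reduceIte, Nat.add_sub_cancel, List.getD_cons_succ]
    rw [castVec, show (0 : ZMod p) = ((0 : ℤ) : ZMod p) from Int.cast_zero.symm, List.getD_map]

/-- The degree of `shiftPoly u` is at most `|u|`. [folklore] -/
theorem degree_shiftPoly_lt (u : List (ZMod p)) : (shiftPoly u).degree < (u.length + 1 : ℕ) := by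
  refine (degree_lt_iff_coeff_zero _ _).2 fun N hN => ?_
  rw [coeff_shiftPoly, if_neg (by omega), List.getD_eq_default _ _ (by omega)]

variable [hp : Fact p.Prime]

/-- Entries are reduced (`p ≥ 1`). [folklore] -/
theorem reducedRows_bMatrix (W : List ℤ) : ReducedRows p (bMatrix p W) := by
  intro r hr
  obtain ⟨j, -, rfl⟩ := List.mem_map.1 hr
  intro x hx
  obtain ⟨i', -, rfl⟩ := List.mem_map.1 hx
  have hp' : (0 : ℤ) < p := by exact_mod_cast hp.out.pos
  exact ⟨Int.emod_nonneg _ hp'.ne', Int.emod_lt_of_pos _ hp'⟩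

/-- Pairing a `range`-indexed row with a vector of the same length is a finite sum. [folklore] -/
theorem dot_map_range {m : ℕ} (g : ℕ → ZMod p) (u : List (ZMod p)) (hu : u.length = m) :
    dot ((List.range m).map g) u = ∑ i ∈ Finset.range m, g i * u.getD i 0 := by
  have h1 : (List.range m).map g = List.ofFn fun i : Fin m => g i := by
    refine List.ext_getElem (by simp) fun i h₁ h₂ => ?_
    simp
  rw [h1, dot_ofFn_left _ _ hu, Finset.sum_range]

/-- **The key identity.** For `u` of length `|W| - 2` and any `j`, pairing the reduced row `j`
with `u` gives the `j`-th coefficient of `Σ_{i'} u_{i'} · (X^{p(i'+1)} mod W̄) - shiftPoly u`.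
[cite: KnuthTAOCP2, §4.6.2 (v Q = v)] -/
theorem dot_bRow {W : List ℤ} (u : List (ZMod p)) (hu : u.length = W.length - 2) (j : ℕ) :
    dot (castVec p (bRow p W j)) u =
      (∑ i' ∈ Finset.range (W.length - 2), u.getD i' 0 • toZMod p (xPowMod p (p * (i' + 1)) W) - shiftPoly u).coeff j := by
  rw [castVec_bRow, dot_map_range _ _ hu, coeff_sub, finsetSum_coeff, coeff_shiftPoly]
  simp only [coeff_smul, smul_eq_mul, sub_mul, Finset.sum_sub_distrib]
  congr 1
  · exact Finset.sum_congr rfl fun i _ => mul_comm _ _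
  · split_ifs with hj
    · subst hj
      exact Finset.sum_eq_zero fun i _ => by rw [if_neg (by omega)]; ring
    · by_cases hlt : j - 1 < W.length - 2
      · rw [Finset.sum_eq_single (j - 1)]
        · rw [if_pos (by omega)]; ring
        · intro i _ hi; rw [if_neg (by omega)]; ring
        · intro h; exact absurd (Finset.mem_range.2 hlt) h
      · rw [List.getD_eq_default _ _ (by omega)]
        exact Finset.sum_eq_zero fun i hi => by rw [if_neg (by have := Finset.mem_range.1 hi; omega)]; ring

/-- The Berlekamp sum over a fixed range: for `deg v̄ < w`,
`Σ_{i<w} v̄ᵢ (X^{qi} mod W̄) = Σ_{i ≤ deg v̄} v̄ᵢ (X^{qi} mod W̄)`. [folklore] -/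
theorem sum_range_coeff_smul_eq {W v : (ZMod p)[X]} {w : ℕ} (hv : v.natDegree < w) :
    ∑ i ∈ Finset.range w, v.coeff i • ((X ^ (p * i)) %ₘ W) =
      ∑ i ∈ Finset.range (v.natDegree + 1), v.coeff i • ((X ^ (Fintype.card (ZMod p) * i)) %ₘ W) := by
  rw [ZMod.card]
  symm
  refine Finset.sum_subset (Finset.range_mono (by omega)) fun i _ hi => ?_
  rw [coeff_eq_zero_of_natDegree_lt (by have := Finset.mem_range.not.1 hi; omega), zero_smul]

/-- The Berlekamp sum of the shifted polynomial, reindexed: for `|u| = |W| - 2` and `|W| ≥ 2`,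
`Σ_{i'<|W|-2} u_{i'} (X^{p(i'+1)} mod W̄) = Σ_{i<|W|-1} (shiftPoly u)ᵢ (X^{pi} mod W̄)`. [folklore] -/
theorem sum_smul_xPowMod_eq {W : List ℤ} (hW0 : W ≠ []) (hWm : (toZMod p W).Monic)
    (hWd : (toZMod p W).natDegree = W.length - 1) (hw : 2 ≤ W.length) (u : List (ZMod p)) :
    ∑ i' ∈ Finset.range (W.length - 2), u.getD i' 0 • toZMod p (xPowMod p (p * (i' + 1)) W) =
      ∑ i ∈ Finset.range (W.length - 1), (shiftPoly u).coeff i • ((X ^ (p * i)) %ₘ toZMod p W) := by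
  have hp0 := hp.out.pos
  rw [show W.length - 1 = (W.length - 2) + 1 by omega, Finset.sum_range_succ']
  rw [coeff_shiftPoly, if_pos rfl, zero_smul, add_zero]
  refine Finset.sum_congr rfl fun i' _ => ?_
  rw [coeff_shiftPoly, if_neg (Nat.succ_ne_zero i'), Nat.add_sub_cancel, (xPowMod_spec hp0 hW0 hWm hWd _).1]

/-- **Soundness of `berlekampVec`.** If a vector `v` is returned (for `W̄` monic of degree
`|W| - 1 ≥ 2`), then `v` is normal, `0 < deg v̄ < deg W̄`, `|v| < |W|`, and `W̄ ∣ v̄^p - v̄`.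
[cite: KnuthTAOCP2, §4.6.2, steps B2–B3] -/
theorem berlekampVec_sound {W v : List ℤ} (hWm : (toZMod p W).Monic) (hWd : (toZMod p W).natDegree = W.length - 1)
    (hw : 3 ≤ W.length) (h : berlekampVec p W = some v) :
    Normal p v ∧ 0 < (toZMod p v).natDegree ∧ (toZMod p v).natDegree < (toZMod p W).natDegree ∧ v.length < W.length ∧
      toZMod p W ∣ toZMod p v ^ p - toZMod p v := by
  have hp0 := hp.out.pos
  have hW0 : W ≠ [] := by rintro rfl; simp at hw
  obtain ⟨c, hc, rfl⟩ : ∃ c, kerVecMod p (W.length - 2) (bMatrix p W) = some c ∧ pnorm p (0 :: c) = v := by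
    unfold berlekampVec at h
    cases hk : kerVecMod p (W.length - 2) (bMatrix p W) with
    | none => rw [hk] at h; simp at h
    | some c => rw [hk] at h; exact ⟨c, rfl, by simpa using h⟩
  obtain ⟨hclen, ⟨x, hx, hx0⟩, horth⟩ := kerVecMod_sound (fun r hr => length_of_mem_bMatrix hr) hc
  set u := castVec p c with hu
  have hulen : u.length = W.length - 2 := by rw [hu, length_castVec, hclen]
  have hvZ : toZMod p (pnorm p (0 :: c)) = shiftPoly u := by rw [toZMod_pnorm, toZMod_zero_cons]
  -- the difference `D = Σ u_{i'} R_{i'+1} - shiftPoly u` has degree `< |W| - 1` and vanishing low coefficients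
  set D := ∑ i' ∈ Finset.range (W.length - 2), u.getD i' 0 • toZMod p (xPowMod p (p * (i' + 1)) W) - shiftPoly u with hD
  have hdegD : D.degree < (W.length - 1 : ℕ) := by
    refine (degree_sub_le _ _).trans_lt (max_lt ?_ ?_)
    · refine (degree_sum_le _ _).trans_lt ((Finset.sup_lt_iff (WithBot.bot_lt_coe _)).2 fun i' _ => ?_)
      refine (degree_smul_le _ _).trans_lt ((degree_toZMod_lt _).trans_le ?_)
      have := (xPowMod_spec hp0 hW0 hWm hWd (p * (i' + 1))).2.2
      exact_mod_cast (by omega)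
    · refine (degree_shiftPoly_lt u).trans_le ?_
      rw [hulen]; exact_mod_cast (by omega)
  have hsys : D = 0 := by
    ext j
    rw [coeff_zero]
    by_cases hj : j < W.length - 1
    · rw [hD, ← dot_bRow u hulen j, hu, ← cast_idot]
      exact horth _ (List.mem_map.2 ⟨j, List.mem_range.2 hj, rfl⟩)
    · exact coeff_eq_zero_of_degree_lt (hdegD.trans_le (by exact_mod_cast not_lt.1 hj))
  -- hence the Berlekamp identity for `v̄ = shiftPoly u`
  have hsum : ∑ i ∈ Finset.range (W.length - 1), (shiftPoly u).coeff i • ((X ^ (p * i)) %ₘ toZMod p W) = shiftPoly u := by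
    rw [← sum_smul_xPowMod_eq hW0 hWm hWd (by omega) u]
    exact sub_eq_zero.1 (hD ▸ hsys)
  -- degrees of `v̄`
  have hv0 : shiftPoly u ≠ 0 := by
    obtain ⟨i', hi', rfl⟩ := List.mem_iff_getElem.1 hx
    intro h0
    have := congrArg (fun q => q.coeff (i' + 1)) h0
    rw [coeff_shiftPoly, if_neg (Nat.succ_ne_zero _), Nat.add_sub_cancel, coeff_zero, hu, castVec,
      List.getD_eq_getElem _ _ (by simpa using hi'), List.getElem_map] at this
    exact hx0 this
  have hdeg_lt : (shiftPoly u).natDegree < W.length - 1 := by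
    have h1 := degree_shiftPoly_lt u
    rw [hulen, show W.length - 2 + 1 = W.length - 1 by omega] at h1
    exact (natDegree_lt_iff_degree_lt hv0).2 h1
  have hdeg_pos : 0 < (shiftPoly u).natDegree := by
    obtain ⟨i', hi', rfl⟩ := List.mem_iff_getElem.1 hx
    have hcoef : (shiftPoly u).coeff (i' + 1) ≠ 0 := by
      rw [coeff_shiftPoly, if_neg (Nat.succ_ne_zero _), Nat.add_sub_cancel, hu, castVec,
        List.getD_eq_getElem _ _ (by simpa using hi'), List.getElem_map]
      exact hx0
    exact Nat.lt_of_lt_of_le (Nat.succ_pos i') (le_natDegree_of_ne_zero hcoef)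
  refine ⟨normal_pnorm hp0 _, by rw [hvZ]; exact hdeg_pos, by rw [hvZ, hWd]; exact hdeg_lt, ?_, ?_⟩
  · calc (pnorm p (0 :: c)).length ≤ (0 :: c).length := length_pnorm_le _
      _ = W.length - 2 + 1 := by rw [List.length_cons, hclen]
      _ < W.length := by omega
  · rw [hvZ]
    have hdeg' : (shiftPoly u).degree < (toZMod p W).degree := by
      rw [degree_eq_natDegree hWm.ne_zero, hWd]
      exact (degree_shiftPoly_lt u).trans_le (by rw [hulen]; exact_mod_cast (by omega))
    have key := (dvd_pow_card_sub_iff_sum_eq hWm hdeg').2 (by rw [← sum_range_coeff_smul_eq hdeg_lt, hsum])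
    rwa [ZMod.card] at key

/-- **Completeness of `berlekampVec`.** If `W̄` is monic of degree `|W| - 1 ≥ 2`, squarefree and NOT
irreducible, then a vector is returned. [cite: KnuthTAOCP2, §4.6.2 (rank of Q - I = deg W - r)] -/
theorem berlekampVec_isSome_of_not_irreducible {W : List ℤ} (hWm : (toZMod p W).Monic)
    (hWd : (toZMod p W).natDegree = W.length - 1) (hw : 3 ≤ W.length) (hsq : Squarefree (toZMod p W))
    (hirr : ¬Irreducible (toZMod p W)) : (berlekampVec p W).isSome = true := by
  have hp0 := hp.out.pos
  have hW0 : W ≠ [] := by rintro rfl; simp at hw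
  obtain ⟨v₀, hv00, hv0pos, hv0lt, hdvd⟩ :=
    exists_berlekamp_coeff_zero_of_not_irreducible hWm hsq (by rw [hWd]; omega) hirr
  rw [hWd] at hv0lt
  rw [ZMod.card] at hdvd
  -- the coefficient vector `u = (v₀₁, …, v₀_{|W|-2})`
  set u : List (ZMod p) := (List.range (W.length - 2)).map fun i' => v₀.coeff (i' + 1) with hu
  have hulen : u.length = W.length - 2 := by simp [hu]
  have hugetD : ∀ i', u.getD i' 0 = if i' < W.length - 2 then v₀.coeff (i' + 1) else 0 := by
    intro i'
    split_ifs with h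
    · rw [hu, List.getD_eq_getElem _ _ (by simpa using h), List.getElem_map, List.getElem_range]
    · rw [List.getD_eq_default _ _ (by rw [hulen]; omega)]
  have hshift : shiftPoly u = v₀ := by
    ext j
    rw [coeff_shiftPoly]
    split_ifs with hj
    · rw [hj, hv00]
    · rw [hugetD]
      split_ifs with h
      · congr 1; omega
      · exact (coeff_eq_zero_of_natDegree_lt (by omega)).symm
  have hsum : ∑ i ∈ Finset.range (W.length - 1), v₀.coeff i • ((X ^ (p * i)) %ₘ toZMod p W) = v₀ := by
    rw [sum_range_coeff_smul_eq hv0lt]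
    refine (dvd_pow_card_sub_iff_sum_eq hWm ?_).1 (by rwa [ZMod.card])
    rw [degree_eq_natDegree hWm.ne_zero, hWd]
    exact_mod_cast (natDegree_lt_iff_degree_lt (by rintro rfl; simp at hv0pos)).1 hv0lt
  have horth : ∀ r ∈ bMatrix p W, dot (castVec p r) u = 0 := by
    intro r hr
    obtain ⟨j, -, rfl⟩ := List.mem_map.1 hr
    rw [dot_bRow u hulen j, sum_smul_xPowMod_eq hW0 hWm hWd (by omega) u, hshift, hsum, sub_self, coeff_zero]
  have hne : ∃ x ∈ u, x ≠ 0 := by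
    refine ⟨v₀.coeff v₀.natDegree, List.mem_map.2 ⟨v₀.natDegree - 1, List.mem_range.2 (by omega), ?_⟩, ?_⟩
    · congr 1; omega
    · rw [← leadingCoeff]; exact leadingCoeff_ne_zero.2 (by rintro rfl; simp at hv0pos)
  have h := kerVecMod_complete (fun r hr => length_of_mem_bMatrix hr) u hulen hne horth
  unfold berlekampVec
  cases hk : kerVecMod p (W.length - 2) (bMatrix p W) with
  | none => rw [hk] at h; simp at h
  | some c => rfl

end Spec

end LLLFactoring

end Literature.Computability.Complexity
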